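import Summits.CriticalPhenomena.PercolationContinuityZ3.Theorems.PercNearOneGluingNoHeavyLowerTailSunflowerMultiPetalRestrict
import Summits.CriticalPhenomena.PercolationContinuityZ3.Theorems.PercNearOneGluingNoHeavyLowerTailSunflowerMultiPetalSlackRigidity
import HarnessLib
import HarnessLib.Audit

/-!
# `NoHeavyLowerTail` (crux stmt-CriticalPhenomena-4575), abstract sunflower cubic, `k` petals: the W-RELATIVE THEOREM T
# (every cube `2^W` that sees three petals has STRICT antipodal Gladkov, `2 ≤ pslack W ∅`) and its slot-form consequence `ZK ≥ 6τ − NtriK`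

Support file (seat `prim-l12-p2` gen 32; `--supports stmt-CriticalPhenomena-4575`; companion of `…SunflowerMultiPetalRestrict` (this gen: `restrict`,
`slackTop_restrict`) and `…SunflowerMultiPetalSlackRigidity` (p366028: THEOREM T on the full cube, `MSunflower.two_le_slackTop_of_three_petals`)).
Everything here is PROVED (no `sorry`, no named fact, no conjecture).  Memo: run/shared/lean/prim/prim-l12/prim-l12-p2/FINDING-g32.md §1.

* **W-RELATIVE THEOREM T** (`two_le_pslack_of_three_petals`, `two_le_pslack_of_three_nonempty_petals`): if three pairwise different petal labels are
  attained by subsets of `W`, then `2 ≤ pslack W ∅ = Σ_{S ⊆ W} kkK (lab S) (lab (W ∖ S))` (`α` need not be finite) — Theorem T applied to `F.restrict W`.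
* Slot language (`[Fintype α]`): `SeesThree K` (three petals attained inside `Kᶜ`), `two_le_pslack_compl_of_seesThree`; `tauThree` = number `τ` of DECIDED
  spectators whose cube sees three petals; **`two_mul_tauThree_le_SwK_decK`** (`2τ ≤ SwK (decK k)`) and **`ZK_ge_of_seesThree`** (`6τ − NtriK ≤ ZK`) — the link
  "Σ_{K decided} s(E∖K) ≥ τ" of memo FINDING-g31 §1.4, now formal.  (★ₖ is `NtriK ≤ 3·SwK (decK k)`; `τ` alone does not pay all rainbows — three atoms
  plus a dummy coordinate have `τ = 2 < 3 = #rainbows` — so this is a lower bound, not a proof of ★ₖ.)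
-/

namespace Summit.CriticalPhenomena.PercolationContinuityZ3.Theorems.SunflowerPartition

open Finset

variable {α : Type*} [DecidableEq α]

namespace MSunflower

variable {k : ℕ} (F : MSunflower k α) (W : Finset α)

/-! ## §3 The W-relative Theorem T -/

/-- **W-RELATIVE THEOREM T.**  If three pairwise different petal labels are attained by subsets of `W`, the antipodal-Gladkov inequality of the cube
`2^W` is STRICT: `2 ≤ pslack W ∅ = Σ_{S ⊆ W} kkK (lab S) (lab (W ∖ S))`. [this work] -/
theorem two_le_pslack_of_three_petals {a b c : Fin (k + 2)} (ha : IsPetalK k a) (hb : IsPetalK k b) (hc : IsPetalK k c)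
    (hab : a ≠ b) (hac : a ≠ c) (hbc : b ≠ c) {Sa Sb Sc : Finset α} (hSaW : Sa ⊆ W) (hSbW : Sb ⊆ W) (hScW : Sc ⊆ W)
    (hSa : F.lab Sa = a) (hSb : F.lab Sb = b) (hSc : F.lab Sc = c) : 2 ≤ F.pslack W ∅ := by
  rw [← F.slackTop_restrict W]
  refine (F.restrict W).two_le_slackTop_of_three_petals ha hb hc hab hac hbc
    (Sa := Sa.subtype (· ∈ W)) (Sb := Sb.subtype (· ∈ W)) (Sc := Sc.subtype (· ∈ W)) ?_ ?_ ?_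
  · rw [lab_restrict, liftW_subtype W hSaW, hSa]
  · rw [lab_restrict, liftW_subtype W hSbW, hSb]
  · rw [lab_restrict, liftW_subtype W hScW, hSc]

/-- W-relative Theorem T for three non-empty petals `i, j, l` seen inside `W`. [this work] -/
theorem two_le_pslack_of_three_nonempty_petals {i j l : Fin k} (hij : i ≠ j) (hil : i ≠ l) (hjl : j ≠ l)
    {Si Sj Sl : Finset α} (hSiW : Si ⊆ W) (hSjW : Sj ⊆ W) (hSlW : Sl ⊆ W)
    (hAi : Si ∉ F.A) (hVi : Si ∈ F.V i) (hAj : Sj ∉ F.A) (hVj : Sj ∈ F.V j) (hAl : Sl ∉ F.A) (hVl : Sl ∈ F.V l) :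
    2 ≤ F.pslack W ∅ :=
  F.two_le_pslack_of_three_petals W ⟨petalLab_ne_zero k i, petalLab_ne_last k i⟩ ⟨petalLab_ne_zero k j, petalLab_ne_last k j⟩
    ⟨petalLab_ne_zero k l, petalLab_ne_last k l⟩
    (fun h => hij (petalLab_injective k h)) (fun h => hil (petalLab_injective k h)) (fun h => hjl (petalLab_injective k h))
    hSiW hSjW hSlW (F.lab_eq_petalLab hAi hVi) (F.lab_eq_petalLab hAj hVj) (F.lab_eq_petalLab hAl hVl)

/-! ## §3b W-relative cover and configuration lemmas (transport of p364652) -/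

/-- `liftW` commutes with `insert`. [this work] -/
theorem liftW_insert (x : {x // x ∈ W}) (S : Finset {x // x ∈ W}) : liftW W (insert x S) = insert (x : α) (liftW W S) := by
  unfold liftW; rw [map_insert]; rfl

/-- The configuration gap of the restriction is the configuration gap of `F` at the lifted sets. [this work] -/
theorem cgap_restrict (X Y : Finset {x // x ∈ W}) (e : {x // x ∈ W}) :
    (F.restrict W).cgap X Y e = F.cgap (liftW W X) (liftW W Y) (e : α) := by
  unfold cgap
  rw [lab_restrict, lab_restrict, lab_restrict, lab_restrict, liftW_insert, liftW_insert]

/-- **W-relative COVER LEMMA**: a white set `Y ⊆ W` with a black upper cover `Y + v ⊆ W` forces `2 ≤ pslack W ∅`. [this work] -/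
theorem two_le_pslack_of_cover {Y : Finset α} {v : α} (hYW : Y ⊆ W) (hvW : v ∈ W) (hv : v ∉ Y) (hY : F.lab Y = 0)
    (hYv : F.lab (insert v Y) = Fin.last (k + 1)) : 2 ≤ F.pslack W ∅ := by
  rw [← F.slackTop_restrict W]
  have hv' : (⟨v, hvW⟩ : {x // x ∈ W}) ∉ Y.subtype (· ∈ W) := by
    rw [mem_subtype]; exact hv
  refine (F.restrict W).two_le_slackTop_of_cover hv' ?_ ?_
  · rw [lab_restrict, liftW_subtype W hYW, hY]
  · rw [lab_restrict, liftW_insert, liftW_subtype W hYW]; exact hYv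

/-- **W-relative CONFIGURATION LEMMA**: a configuration `(X, Y; e)` inside `W` (`v ∈ X ∖ Y`, `e ∈ W ∖ (X ∪ Y)`) with positive gap forces
`2 ≤ pslack W ∅`. [this work] -/
theorem two_le_pslack_of_cgap_pos {X Y : Finset α} {v e : α} (hXW : X ⊆ W) (hYW : Y ⊆ W) (heW : e ∈ W)
    (hvX : v ∈ X) (hvY : v ∉ Y) (heX : e ∉ X) (heY : e ∉ Y) (hgap : 1 ≤ F.cgap X Y e) : 2 ≤ F.pslack W ∅ := by
  rw [← F.slackTop_restrict W]
  have hvW : v ∈ W := hXW hvX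
  refine (F.restrict W).two_le_slackTop_of_cgap_pos (X := X.subtype (· ∈ W)) (Y := Y.subtype (· ∈ W))
    (v := ⟨v, hvW⟩) (e := ⟨e, heW⟩) ?_ ?_ ?_ ?_ ?_
  · rw [mem_subtype]; exact hvX
  · rw [mem_subtype]; exact hvY
  · rw [mem_subtype]; exact heX
  · rw [mem_subtype]; exact heY
  · rw [cgap_restrict, liftW_subtype W hXW, liftW_subtype W hYW]; exact hgap

/-! ## §4 Slot language: decided spectators whose cube sees three petals -/

section Slots

variable [Fintype α]

/-- The cube `2^{α ∖ K}` SEES THREE PETALS: three pairwise different petal labels are attained by sets disjoint from `K`. [this work] -/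
def SeesThree (K : Finset α) : Prop :=
  ∃ a b c : Fin (k + 2), ∃ Sa Sb Sc : Finset α, IsPetalK k a ∧ IsPetalK k b ∧ IsPetalK k c ∧ a ≠ b ∧ a ≠ c ∧ b ≠ c ∧
    Sa ⊆ Kᶜ ∧ Sb ⊆ Kᶜ ∧ Sc ⊆ Kᶜ ∧ F.lab Sa = a ∧ F.lab Sb = b ∧ F.lab Sc = c

/-- A spectator whose cube sees three petals supplies at least `2` (twice the strict antipodal-Gladkov unit). [this work] -/
theorem two_le_pslack_compl_of_seesThree {K : Finset α} (h : F.SeesThree K) : 2 ≤ F.pslack Kᶜ ∅ := by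
  obtain ⟨a, b, c, Sa, Sb, Sc, ha, hb, hc, hab, hac, hbc, hSa, hSb, hSc, hla, hlb, hlc⟩ := h
  exact F.two_le_pslack_of_three_petals Kᶜ ha hb hc hab hac hbc hSa hSb hSc hla hlb hlc

/-- The number `τ` of DECIDED spectators (top or bottom label) whose cube sees three petals. [this work] -/
noncomputable def tauThree : ℕ := by
  classical exact (univ.filter fun K : Finset α => decK k (F.lab K) = 1 ∧ F.SeesThree K).card

/-- `decK` takes the values `0` and `1`. [this work] -/
theorem decK_eq_zero_or_one (v : Fin (k + 2)) : decK k v = 0 ∨ decK k v = 1 := by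
  unfold decK; split_ifs
  · exact Or.inr rfl
  · exact Or.inl rfl

/-- **`SwK (decK k) ≥ 2 τ`**: the total antipodal slack of the decided spectators is at least twice the number of decided spectators whose cube sees
three petals (the link "Σ_{K decided} s(E∖K) ≥ τ" of memo FINDING-g31 §1.4). [this work] -/
theorem two_mul_tauThree_le_SwK_decK : 2 * (F.tauThree : ℤ) ≤ F.SwK (decK k) := by
  classical
  rw [F.SwK_eq_sum_pslack]
  have hsplit : ∑ K : Finset α, decK k (F.lab K) * F.pslack Kᶜ ∅
      = ∑ K ∈ univ.filter (fun K : Finset α => decK k (F.lab K) = 1 ∧ F.SeesThree K), decK k (F.lab K) * F.pslack Kᶜ ∅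
        + ∑ K ∈ univ.filter (fun K : Finset α => ¬ (decK k (F.lab K) = 1 ∧ F.SeesThree K)), decK k (F.lab K) * F.pslack Kᶜ ∅ :=
    (sum_filter_add_sum_filter_not univ _ _).symm
  rw [hsplit]
  have h1 : 2 * (F.tauThree : ℤ)
      ≤ ∑ K ∈ univ.filter (fun K : Finset α => decK k (F.lab K) = 1 ∧ F.SeesThree K), decK k (F.lab K) * F.pslack Kᶜ ∅ := by
    have hcard : (F.tauThree : ℤ) = ∑ _K ∈ univ.filter (fun K : Finset α => decK k (F.lab K) = 1 ∧ F.SeesThree K), (1 : ℤ) := by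
      unfold tauThree
      simp
    rw [hcard, mul_sum]
    refine sum_le_sum fun K hK => ?_
    obtain ⟨hdec, hsees⟩ := (mem_filter.1 hK).2
    rw [hdec, one_mul, mul_one]
    exact F.two_le_pslack_compl_of_seesThree hsees
  have h2 : 0 ≤ ∑ K ∈ univ.filter (fun K : Finset α => ¬ (decK k (F.lab K) = 1 ∧ F.SeesThree K)),
      decK k (F.lab K) * F.pslack Kᶜ ∅ :=
    sum_nonneg fun K _ => mul_nonneg (by rcases decK_eq_zero_or_one (F.lab K) with h | h <;> simp [h]) (F.pslack_nonneg _ _)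
  linarith

/-- Hence **`ZK ≥ 6 τ − NtriK`**: in the slot form `ZK = 3·SwK [decided] − NtriK` the decided spectators seeing three petals alone pay `6 τ`
(Theorem T on every sub-cube).  [this work] -/
theorem ZK_ge_of_seesThree : 6 * (F.tauThree : ℤ) - F.NtriK ≤ F.ZK := by
  rw [F.ZK_eq_spec]
  have := F.two_mul_tauThree_le_SwK_decK
  linarith

end Slots

end MSunflower

end Summit.CriticalPhenomena.PercolationContinuityZ3.Theorems.SunflowerPartition
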